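import Mathlib
import HarnessLib
import Summits.Ventures.LatticeQCDFlow.Scoring.KernelTransitionOperator
import Summits.Ventures.LatticeQCDFlow.Scoring.VarianceOfTheMean
import Summits.Ventures.LatticeQCDFlow.Exactness.IMHKernel
import Summits.Ventures.LatticeQCDFlow.Exactness.FlowSamplerLogConvex

/-!
# The flow-MCMC KERNEL is a positive operator: `kop (indepMH q w) = imhOp q w 1`, nonnegative
# log-convex autocorrelations, `τ_N ≤ τ_W ≤ τ_int`, and the floor `(1 + ρ₁)/(2(1 − ρ₁)) ≤ τ_int`

HONEST FRAMING: exact (Metropolis-corrected) sampling algorithms for lattice gauge theory;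
figures of merit are autocorrelation/cost numbers at stated couplings and volumes; no
continuum-physics claim.

Venture `LatticeQCDFlow` (cell pub-lqcd), topic `Scoring`; FANOUT row 8 (`s0-cpn-nemc`, GEN-11).
NEW WORK of the cell (a dictionary and its corollaries), not a published result.  It identifies two
tree objects: row 30's flow-MCMC KERNEL `Exactness.indepMH q w : Kernel Ω Ω`
(`Exactness/IMHKernel.lean`: propose from the model law `q`, accept with `min(1, w y / w x)`), on
which rows 8/30 state exactness, Doeblin, the envelope and the Green–Kubo law
(`Scoring/KernelTransitionOperator.lean`: `kop`, `autocov`; `Scoring/FlowSamplerAutocorrelation.lean`;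
`Exactness/ApproxTrivializingSampler.lean`), and row 2's OPERATOR `Exactness.imhOp μ w q̃`
(`Exactness/FlowSamplerOperator.lean`), for which row 2 proved positivity and log-convexity
(`Exactness/FlowSamplerPositive.lean`, `Exactness/FlowSamplerLogConvex.lean`; printed counterparts
Liu 1996 and Madras–Slade 1993 Prop. 9.2.2 are NAMED ONLY there).  Nothing is cited as a fact.

## What is proved

* §1 (any measurable space; `q` a probability law, `w > 0` measurable, `g` bounded measurable)
  `indepMH_apply_eq` (`K(x,·) = a(x,·)·q + (1 − A(x)) δ_x` as a measure), `toReal_imhAcceptMass`,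
  **`kop_indepMH`** (`(kop K g)(x) = ∫ [a(x,y) g(y) + (1 − a(x,y)) g(x)] dq(y)`),
  **`kop_indepMH_eq_imhOp`**: THE DICTIONARY `kop (indepMH q w) g = imhOp q w 1 g` (row 2's operator
  with reference measure `q`, target weight `w`, proposal density `1`), `iterate_kop_indepMH_eq`, and
  **`autocov_indepMH_eq`**: `Scoring.autocov (indepMH q w) (w·q) g t = ∫ g · (imhOp q w 1)^[t] g · w dq`.
* §2 (same, and `π = w·q` named through `hπ : q.withDensity w = π`, `w` `q`-integrable;
  `C_g(t) = autocov (indepMH q w) π g t`, `ρ(t) = C_g(t)/C_g(0)`):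
  **`indepMH_autocov_nonneg`** (`0 ≤ C_g(t)` for EVERY `t` and every bounded measurable `g`, centred
  or not), **`indepMH_autocov_logConvex`** (`C_g(t+1)² ≤ C_g(t) C_g(t+2)`), `indepMH_acf_nonneg`,
  **`indepMH_acf_pow_le`** (`ρ(1)^t ≤ ρ(t)`), `tauIntN_le_tauIntWindow_of_nonneg` (sequences:
  `τ_N ≤ τ_W(N)` when `ρ ≥ 0`), **`indepMH_tauIntN_le_tauIntWindow`**, `indepMH_tauIntWindow_mono`,
  **`indepMH_tauIntWindow_le_tauInt`**, **`indepMH_tauIntN_le_tauInt`** (for a summable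
  autocorrelation EVERY Γ-window `τ_W` and every finite-`N` variance-of-the-mean time `τ_N`
  (`Scoring/VarianceOfTheMean.lean`) is `≤ τ_int`: windowed figures of the exact flow sampler are
  certified LOWER bounds, observable by observable), and **`indepMH_tauInt_floor`** (`ρ(1) < 1` and
  `(1 + ρ(1))/(2(1 − ρ(1))) ≤ τ_int`).

The lattice instance (`SU(n)^E`, unconditional, with row 8's ceiling `e^{2δ} − 1/2`) is
`Scoring/FlowSamplerAutocorrelationFloor.lean`.  Reading (markdown): for the exact flow sampler the
scorers' windowed `τ̂` under-reads the figure of merit in SIGN for every observable at the kernel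
level; the size of the under-read is what the envelope and the finite-pool bracket
(`Scoring/IMHWindowBracket.lean`) control.  NOT CLAIMED: anything for HMC / heat bath / local
Metropolis (not positive operators; `Scoring/ReversibleKernelTauIntFloor.lean` has what
reversibility alone gives), unbounded observables, estimator (noise) statements, any number of ours.
-/

noncomputable section

namespace Summit.Ventures.LatticeQCDFlow.Scoring

open MeasureTheory ProbabilityTheory Filter Finset Summit.Ventures.LatticeQCDFlow.Exactness
open scoped ENNReal Topology

variable {Ω : Type*} [MeasurableSpace Ω]

/-! ### §1 The dictionary `kop (indepMH q w) = imhOp q w 1` -/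

section Dictionary

variable {q : Measure Ω} [IsProbabilityMeasure q] {w : Ω → ℝ}

/-- The flow-MCMC kernel from `x` as a measure: `K(x, ·) = a(x, ·) · q + (1 − A(x)) · δ_x`. -/
theorem indepMH_apply_eq (hw : Measurable w) (x : Ω) :
    indepMH q w x =
      q.withDensity (imhAcceptE w x) + (1 - imhAcceptMass q w x) • Measure.dirac x := by
  have h2 : Measurable (Function.uncurry fun (x : Ω) (_ : Ω) => 1 - imhAcceptMass q w x) :=
    measurable_const.sub ((measurable_imhAcceptMass q hw).comp measurable_fst)
  rw [indepMH, Kernel.add_apply, Kernel.withDensity_apply _ (measurable_imhAcceptE hw),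
    Kernel.const_apply, Kernel.withDensity_apply _ h2, Kernel.deterministic_apply, id,
    withDensity_const]

/-- The acceptance function from `x` is measurable in the proposal. -/
theorem measurable_imhAccept_right (hw : Measurable w) (x : Ω) : Measurable (imhAccept w x) := by
  show Measurable fun y => min 1 (w y / w x)
  exact measurable_const.min (hw.div_const (w x))

omit [IsProbabilityMeasure q] in
/-- The acceptance mass in real form: `A(x).toReal = ∫ a(x, y) dq(y)`. -/
theorem toReal_imhAcceptMass (hw : Measurable w) (hw0 : ∀ x, 0 < w x) (x : Ω) :
    (imhAcceptMass q w x).toReal = ∫ y, imhAccept w x y ∂q := by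
  rw [integral_eq_lintegral_of_nonneg_ae (ae_of_all _ (imhAccept_nonneg hw0 x))
    (measurable_imhAccept_right hw x).aestronglyMeasurable]
  rfl

/-- **`kop` of the flow-MCMC kernel**: `(kop K g)(x) = ∫ [a(x,y) g(y) + (1 − a(x,y)) g(x)] dq(y)` for
bounded measurable `g`. -/
theorem kop_indepMH (hw : Measurable w) (hw0 : ∀ x, 0 < w x) {g : Ω → ℝ} (hg : Measurable g)
    {C : ℝ} (hC : ∀ x, |g x| ≤ C) (x : Ω) :
    kop (indepMH q w) g x = ∫ y, (imhAccept w x y * g y + (1 - imhAccept w x y) * g x) ∂q := by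
  have ham := measurable_imhAccept_right hw x
  have ha0 : ∀ y, 0 ≤ imhAccept w x y := imhAccept_nonneg hw0 x
  have ha1 : ∀ y, imhAccept w x y ≤ 1 := imhAccept_le_one w x
  have hab : ∀ y, |imhAccept w x y| ≤ 1 := fun y => by rw [abs_of_nonneg (ha0 y)]; exact ha1 y
  have haE : Measurable (imhAcceptE w x) := (measurable_imhAcceptE hw).of_uncurry_left
  have hle : q.withDensity (imhAcceptE w x) ≤ q := by
    calc q.withDensity (imhAcceptE w x) ≤ q.withDensity 1 :=
          withDensity_mono (ae_of_all _ fun y => imhAcceptE_le_one w x y)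
      _ = q := withDensity_one
  have hA1 : imhAcceptMass q w x ≤ 1 := imhAcceptMass_le_one q w x
  have hAtop : 1 - imhAcceptMass q w x ≠ ⊤ := ne_top_of_le_ne_top ENNReal.one_ne_top tsub_le_self
  have hI1 : Integrable g (q.withDensity (imhAcceptE w x)) :=
    (integrable_of_bounded q hg hC).mono_measure hle
  have hI2 : Integrable g ((1 - imhAcceptMass q w x) • Measure.dirac x) :=
    (integrable_of_bounded (Measure.dirac x) hg hC).smul_measure hAtop
  have hIa : Integrable (imhAccept w x) q := integrable_of_bounded q ham hab
  have hIag : Integrable (fun y => imhAccept w x y * g y) q :=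
    integrable_of_bounded q (ham.mul hg) (C := 1 * C) fun y => by
      rw [abs_mul]; exact mul_le_mul (hab y) (hC y) (abs_nonneg _) zero_le_one
  have hIrest : Integrable (fun y => (1 - imhAccept w x y) * g x) q :=
    ((integrable_const 1).sub hIa).mul_const (g x)
  unfold kop
  rw [indepMH_apply_eq hw x, integral_add_measure hI1 hI2,
    integral_withDensity_eq_integral_toReal_smul haE (ae_of_all _ fun y => ENNReal.ofReal_lt_top),
    integral_smul_measure, integral_dirac' _ _ hg.stronglyMeasurable,
    ENNReal.toReal_sub_of_le hA1 ENNReal.one_ne_top, ENNReal.toReal_one,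
    toReal_imhAcceptMass hw hw0, integral_add hIag hIrest, integral_mul_const,
    integral_sub (integrable_const _) hIa, integral_const, probReal_univ, one_smul, smul_eq_mul]
  congr 1
  refine integral_congr_ae (ae_of_all _ fun y => ?_)
  show (imhAcceptE w x y).toReal • g y = imhAccept w x y * g y
  rw [imhAcceptE, ENNReal.toReal_ofReal (ha0 y), smul_eq_mul]

/-- **THE DICTIONARY**: the transition operator of row 30's flow-MCMC kernel IS row 2's operator with
reference measure `q`, target weight `w` and proposal density `1`:
`kop (indepMH q w) g = imhOp q w 1 g` for bounded measurable `g`. -/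
theorem kop_indepMH_eq_imhOp (hw : Measurable w) (hw0 : ∀ x, 0 < w x) {g : Ω → ℝ}
    (hg : Measurable g) {C : ℝ} (hC : ∀ x, |g x| ≤ C) :
    kop (indepMH q w) g = imhOp q w (fun _ => (1 : ℝ)) g := by
  funext x
  rw [kop_indepMH hw hw0 hg hC x]
  unfold imhOp imhAcceptQ
  refine integral_congr_ae (ae_of_all _ fun y => ?_)
  simp only [mul_one, imhAccept]

/-- … hence so are all iterates: `(kop K)^[t] g = (imhOp q w 1)^[t] g`. -/
theorem iterate_kop_indepMH_eq (hw : Measurable w) (hw0 : ∀ x, 0 < w x) {C : ℝ} :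
    ∀ (t : ℕ) {g : Ω → ℝ}, Measurable g → (∀ x, |g x| ≤ C) →
      (kop (indepMH q w))^[t] g = (imhOp q w (fun _ => (1 : ℝ)))^[t] g
  | 0, _, _, _ => rfl
  | t + 1, g, hg, hC => by
    haveI : Fact (Measurable w) := ⟨hw⟩
    rw [Function.iterate_succ_apply, Function.iterate_succ_apply, ← kop_indepMH_eq_imhOp hw hw0 hg hC]
    exact iterate_kop_indepMH_eq hw hw0 t (measurable_kop _ hg) (abs_kop_le _ hC)

/-- **The tree's `autocov` of the flow-MCMC kernel under its target `π = w · q` is row 2's weighted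
two-time form**: `autocov (indepMH q w) (w·q) g t = ∫ g · (imhOp q w 1)^[t] g · w dq`. -/
theorem autocov_indepMH_eq (hw : Measurable w) (hw0 : ∀ x, 0 < w x) {g : Ω → ℝ}
    (hg : Measurable g) {C : ℝ} (hC : ∀ x, |g x| ≤ C) (t : ℕ) :
    autocov (indepMH q w) (q.withDensity fun x => ENNReal.ofReal (w x)) g t
      = ∫ x, g x * ((imhOp q w (fun _ => (1 : ℝ)))^[t] g) x * w x ∂q := by
  unfold autocov
  rw [integral_withDensity_eq_integral_toReal_smul hw.ennreal_ofReal
      (ae_of_all _ fun x => ENNReal.ofReal_lt_top), iterate_kop_indepMH_eq hw hw0 t hg hC]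
  refine integral_congr_ae (ae_of_all _ fun x => ?_)
  show (ENNReal.ofReal (w x)).toReal • (g x * ((imhOp q w (fun _ => (1 : ℝ)))^[t] g) x) = _
  rw [ENNReal.toReal_ofReal (hw0 x).le, smul_eq_mul]
  ring

end Dictionary

/-! ### §2 Consequences for the kernel: positivity, log-convexity, windows below `τ_int`, the floor -/

section Kernel

variable {q : Measure Ω} [IsProbabilityMeasure q] {w : Ω → ℝ} {π : Measure Ω}

/-- **EVERY STATIONARY AUTOCOVARIANCE OF THE FLOW-MCMC KERNEL IS NONNEGATIVE**: with the target
`π = w · q`, `0 ≤ autocov (indepMH q w) π g t` for every bounded measurable `g` (centred or not) and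
every lag `t` — row 2's positivity of `imhOp` transported through the dictionary. -/
theorem indepMH_autocov_nonneg (hw : Measurable w) (hw0 : ∀ x, 0 < w x) (hwi : Integrable w q)
    (hπ : (q.withDensity fun x => ENNReal.ofReal (w x)) = π)
    {g : Ω → ℝ} (hg : Measurable g) {C : ℝ} (hC : ∀ x, |g x| ≤ C) (t : ℕ) :
    0 ≤ autocov (indepMH q w) π g t := by
  subst hπ
  rw [autocov_indepMH_eq hw hw0 hg hC t]
  exact autocov_nonneg hw0 hw hwi (fun _ => one_pos) measurable_const (integrable_const _)
    (by simp) hg hC t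

/-- **THE AUTOCOVARIANCE SEQUENCE OF THE FLOW-MCMC KERNEL IS LOG-CONVEX**:
`C_g(t+1)² ≤ C_g(t) · C_g(t+2)`. -/
theorem indepMH_autocov_logConvex (hw : Measurable w) (hw0 : ∀ x, 0 < w x) (hwi : Integrable w q)
    (hπ : (q.withDensity fun x => ENNReal.ofReal (w x)) = π)
    {g : Ω → ℝ} (hg : Measurable g) {C : ℝ} (hC : ∀ x, |g x| ≤ C) (t : ℕ) :
    autocov (indepMH q w) π g (t + 1) ^ 2
      ≤ autocov (indepMH q w) π g t * autocov (indepMH q w) π g (t + 2) := by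
  subst hπ
  rw [autocov_indepMH_eq hw hw0 hg hC, autocov_indepMH_eq hw hw0 hg hC,
    autocov_indepMH_eq hw hw0 hg hC]
  exact autocov_logConvex hw0 hw hwi (fun _ => one_pos) measurable_const (integrable_const _)
    (by simp) hg hC t

/-- Normalised form: `0 ≤ ρ(t)`. -/
theorem indepMH_acf_nonneg (hw : Measurable w) (hw0 : ∀ x, 0 < w x) (hwi : Integrable w q)
    (hπ : (q.withDensity fun x => ENNReal.ofReal (w x)) = π)
    {g : Ω → ℝ} (hg : Measurable g) {C : ℝ} (hC : ∀ x, |g x| ≤ C) (t : ℕ) :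
    0 ≤ autocov (indepMH q w) π g t / autocov (indepMH q w) π g 0 :=
  div_nonneg (indepMH_autocov_nonneg hw hw0 hwi hπ hg hC t)
    (indepMH_autocov_nonneg hw hw0 hwi hπ hg hC 0)

/-- **`ρ(1)ᵗ ≤ ρ(t)`**: the autocorrelation of every bounded observable of the flow-MCMC kernel
dominates the geometric (AR(1)) sequence through its own lag-one value. -/
theorem indepMH_acf_pow_le (hw : Measurable w) (hw0 : ∀ x, 0 < w x) (hwi : Integrable w q)
    (hπ : (q.withDensity fun x => ENNReal.ofReal (w x)) = π)
    {g : Ω → ℝ} (hg : Measurable g) {C : ℝ} (hC : ∀ x, |g x| ≤ C) (t : ℕ) :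
    (autocov (indepMH q w) π g 1 / autocov (indepMH q w) π g 0) ^ (t + 1)
      ≤ autocov (indepMH q w) π g (t + 1) / autocov (indepMH q w) π g 0 :=
  logConvex_ratio_pow_le (a := fun t => autocov (indepMH q w) π g t)
    (indepMH_autocov_nonneg hw hw0 hwi hπ hg hC) (indepMH_autocov_logConvex hw hw0 hwi hπ hg hC) t

/-- For a NONNEGATIVE autocorrelation sequence the finite-`N` variance-of-the-mean time is below the
window-`N` truncated sum: `τ_N ≤ τ_W(N)` (Fejér weights `1 − t/N ≤ 1`). -/
theorem tauIntN_le_tauIntWindow_of_nonneg {ρ : ℕ → ℝ} (h : ∀ n, 0 ≤ ρ (n + 1)) (N : ℕ) :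
    tauIntN ρ N ≤ tauIntWindow ρ N := by
  unfold tauIntN tauIntWindow
  have hs : ∑ t ∈ Finset.range N, (1 - ((t : ℝ) + 1) / N) * ρ (t + 1)
      ≤ ∑ t ∈ Finset.range N, ρ (t + 1) :=
    Finset.sum_le_sum fun t _ => mul_le_of_le_one_left (h t) (by
      have : 0 ≤ ((t : ℝ) + 1) / N := by positivity
      linarith)
  linarith

/-- **`τ_N ≤ τ_W(N)`** for every bounded observable of the flow-MCMC kernel. -/
theorem indepMH_tauIntN_le_tauIntWindow (hw : Measurable w) (hw0 : ∀ x, 0 < w x)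
    (hwi : Integrable w q) (hπ : (q.withDensity fun x => ENNReal.ofReal (w x)) = π)
    {g : Ω → ℝ} (hg : Measurable g) {C : ℝ} (hC : ∀ x, |g x| ≤ C) (N : ℕ) :
    tauIntN (fun t => autocov (indepMH q w) π g t / autocov (indepMH q w) π g 0) N
      ≤ tauIntWindow (fun t => autocov (indepMH q w) π g t / autocov (indepMH q w) π g 0) N :=
  tauIntN_le_tauIntWindow_of_nonneg (fun n => indepMH_acf_nonneg hw hw0 hwi hπ hg hC (n + 1)) N

/-- **Γ-windows are monotone**: `W ↦ τ_W` is nondecreasing for every bounded observable. -/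
theorem indepMH_tauIntWindow_mono (hw : Measurable w) (hw0 : ∀ x, 0 < w x) (hwi : Integrable w q)
    (hπ : (q.withDensity fun x => ENNReal.ofReal (w x)) = π)
    {g : Ω → ℝ} (hg : Measurable g) {C : ℝ} (hC : ∀ x, |g x| ≤ C) :
    Monotone (tauIntWindow fun t => autocov (indepMH q w) π g t / autocov (indepMH q w) π g 0) :=
  tauIntWindow_mono_of_nonneg fun n => indepMH_acf_nonneg hw hw0 hwi hπ hg hC (n + 1)

/-- **`τ_W ≤ τ_int`** for every window, whenever the autocorrelation series is summable: windowing
UNDER-estimates the integrated autocorrelation time of every bounded observable of the flow sampler. -/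
theorem indepMH_tauIntWindow_le_tauInt (hw : Measurable w) (hw0 : ∀ x, 0 < w x)
    (hwi : Integrable w q) (hπ : (q.withDensity fun x => ENNReal.ofReal (w x)) = π)
    {g : Ω → ℝ} (hg : Measurable g) {C : ℝ} (hC : ∀ x, |g x| ≤ C)
    (hs : Summable fun t => autocov (indepMH q w) π g (t + 1) / autocov (indepMH q w) π g 0)
    (W : ℕ) :
    tauIntWindow (fun t => autocov (indepMH q w) π g t / autocov (indepMH q w) π g 0) W
      ≤ tauInt (fun t => autocov (indepMH q w) π g t / autocov (indepMH q w) π g 0) :=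
  tauIntWindow_le_tauInt_of_nonneg (fun n => indepMH_acf_nonneg hw hw0 hwi hπ hg hC (n + 1)) hs W

/-- **`τ_N ≤ τ_int`**: the finite-`N` variance of the mean of every bounded observable, in units of
`Var_π g / N`, never exceeds `2 τ_int` — a statement about the TRUE chain's `τ_N`
(`Scoring/VarianceOfTheMean.lean`), not about an estimator's noise. -/
theorem indepMH_tauIntN_le_tauInt (hw : Measurable w) (hw0 : ∀ x, 0 < w x)
    (hwi : Integrable w q) (hπ : (q.withDensity fun x => ENNReal.ofReal (w x)) = π)
    {g : Ω → ℝ} (hg : Measurable g) {C : ℝ} (hC : ∀ x, |g x| ≤ C)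
    (hs : Summable fun t => autocov (indepMH q w) π g (t + 1) / autocov (indepMH q w) π g 0)
    (N : ℕ) :
    tauIntN (fun t => autocov (indepMH q w) π g t / autocov (indepMH q w) π g 0) N
      ≤ tauInt (fun t => autocov (indepMH q w) π g t / autocov (indepMH q w) π g 0) :=
  (indepMH_tauIntN_le_tauIntWindow hw hw0 hwi hπ hg hC N).trans
    (indepMH_tauIntWindow_le_tauInt hw hw0 hwi hπ hg hC hs N)

/-- **THE `τ_int` FLOOR OF THE FLOW-MCMC KERNEL**: for every bounded observable with a summable
autocorrelation, `ρ(1) < 1` and `(1 + ρ(1))/(2(1 − ρ(1))) ≤ τ_int` (the AR(1) value through the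
observable's own lag-one autocorrelation; `Var = 0` gives `ρ ≡ 0` and `1/2 ≤ 1/2`). -/
theorem indepMH_tauInt_floor (hw : Measurable w) (hw0 : ∀ x, 0 < w x) (hwi : Integrable w q)
    (hπ : (q.withDensity fun x => ENNReal.ofReal (w x)) = π)
    {g : Ω → ℝ} (hg : Measurable g) {C : ℝ} (hC : ∀ x, |g x| ≤ C)
    (hs : Summable fun t => autocov (indepMH q w) π g (t + 1) / autocov (indepMH q w) π g 0) :
    autocov (indepMH q w) π g 1 / autocov (indepMH q w) π g 0 < 1 ∧
      (1 + autocov (indepMH q w) π g 1 / autocov (indepMH q w) π g 0)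
          / (2 * (1 - autocov (indepMH q w) π g 1 / autocov (indepMH q w) π g 0))
        ≤ tauInt (fun t => autocov (indepMH q w) π g t / autocov (indepMH q w) π g 0) :=
  tauInt_ge_of_pow_le (ρ := fun t => autocov (indepMH q w) π g t / autocov (indepMH q w) π g 0)
    (indepMH_acf_nonneg hw hw0 hwi hπ hg hC 1) (indepMH_acf_pow_le hw hw0 hwi hπ hg hC) hs

end Kernel

end Summit.Ventures.LatticeQCDFlow.Scoring

end
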